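import Summits.BirchSwinnertonDyer.BirchSwinnertonDyer.Theorems.CycTangentCMCycTangentBoundFrameSignOfSelfDual
import Literature.NumberTheory.EllipticCurves.KatzSelfDualFunctionalEquationCM
import HarnessLib

set_option linter.dupNamespace false
set_option autoImplicit false

/-!
# Crux `CycTangentCM.CycTangentBound` (stmt-BirchSwinnertonDyer-22628), line `tangent-cone-parity`:
# `stub_frameSign` PROVED MODULO ONE NAMED FACT — de Shalit's `p`-adic functional equation on the
# self-dual branch `ψ_A⁻¹` (II.6.4 (9)/(15) with II.6.5 (18)), stated over the frame `IsKatzMeasure₂`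

Route `CycTangentCM` (D-0145 line of ideator bsd-idea-2; K6 leaf `BSDpOnClassX9`); lead seat
`bsd-line-ctcm-p1`, this file by seat `bsd-line-ctcm-p2`.  The seat's helper chain
(`…FrameSignNormalForm`, `…Characters`, `…Roots`, `…Parity`, `…Tangent`, `…OfSelfDual`) proves the
registered stub `stub_frameSign` from ONE hypothesis, the self-dual pointwise relation (SD) of the
`ψ⁻¹`-frame.  Here (SD) is the tree's named fact
`Literature.NumberTheory.EllipticCurves.DeShalit1987.thmII64_selfDual_functionalEquation_cm`
(`Literature/NumberTheory/EllipticCurves/KatzSelfDualFunctionalEquationCM.lean`), de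
Shalit 1987 II.6.4 Theorem (i) in its measure form (15) on `Gal(K_∞/K) ≅ ℤ_p²`, specialised to the
branch of `ε_H = ψ_A⁻¹` which is ANTICYCLOTOMIC in de Shalit's sense (`ε̌ = ε`, II.6.5: for the
Grössencharacter `ψ = ψ_{A/K}` of a CM curve `A/ℚ`, `ψ(𝔞̄) = ψ̄(𝔞)` and `ψψ̄ = N`, so
`(ψ⁻¹)̌(𝔞) = ψ(𝔞̄)N𝔞⁻¹ = ψ⁻¹(𝔞)`), with the sign `sgn(ψ⁻¹) = W^{padic}(ψ⁻¹)·ψ⁻¹(σ_{−1}) = ±1` of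
(18) — and `stub_frameSign_of_fact` derives the stub's conclusion from it (kernel algebra only).

HONEST FRAMING.  The fact is CITE-ONLY (no `_holds`): `stub_frameSign` becomes «PUB modulo
`DeShalit1987.thmII64_selfDual_functionalEquation_cm`»; `stub_higherContact` (the crux's open content, `λ̄_cyc ≥ 4`) is
untouched; nothing is asserted about any curve beyond the cited statement.  BSD is not proved by this.

References: [deShalit1987] II.6.1 (1)–(2) (store chunk 81), II.6.4 Theorem (i) (8)–(9) and proof (13)–(15)
(store chunk 84–85), II.6.5 (17)–(18) (store chunk 86), II.1.4 (11)–(12) (store chunk 34–35); [SilvermanATAEC1994] II Thm. 9.2,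
Thm. 10.5 (b) (`L(A/ℚ, s) = L(s, ψ_{A/K})`, `ψ(𝔞̄) = ψ̄(𝔞)`); [Rubin1991] §4 p. 36, §12 p. 66–67;
[BleherEtAl2015] Lemma 3.3.2 (the functional equation at the level of branches).
-/

noncomputable section

open scoped Classical
open NumberField IsDedekindDomain Field Literature.NumberTheory.EllipticCurves
  Literature.NumberTheory.GaloisRepresentations
  Summit.BirchSwinnertonDyer.BirchSwinnertonDyer.Theorems.CycTangentCMCycTangentBoundFrameSignOfSelfDual

namespace Summit.BirchSwinnertonDyer.BirchSwinnertonDyer.Theorems.CycTangentCMCycTangentBoundFrameSignFact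

/-- **`stub_frameSign` of line `tangent-cone-parity`, PROVED MODULO the named fact
`DeShalit1987.thmII64_selfDual_functionalEquation_cm`** (de Shalit II.6.4/II.6.5 on the self-dual branch): the registered
stub's statement VERBATIM, behind the single hypothesis `hF`.  Kernel algebra: `stub_frameSign_of_selfDual`
(normal form + parity half + tangent half).  CONDITIONAL: the fact has no `_holds`; closes nothing by
itself. [cite: deShalit1987, II.6.4 Theorem (i) (9), (15) and II.6.5 (18) (store chunk 84–86)] -/
theorem stub_frameSign_of_fact (hF : DeShalit1987.thmII64_selfDual_functionalEquation_cm)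
    (A : WeierstrassCurve ℚ) [A.IsElliptic] [A.IsGloballyMinimal] (p : ℕ) [Fact p.Prime]
    (hp : 5 ≤ p) (hj : A.j ∈ maximalCMJInvariants) (hgood : A.HasGoodReductionAtPrime p)
    (hord : ¬ (p : ℤ) ∣ A.frobeniusTrace p) (hirr : A.HasIrreducibleModPGaloisRep p)
    (K : Type) [Field K] [NumberField K] (hK : IsCMFieldOfJ K A.j)
    (ψ : HeckeCharacter K) (hψ : ψ.HasInfinityType (fun _ ↦ 1) (fun _ ↦ 0))
    (hL : ∀ s : ℂ, 3 / 2 < s.re → heckeLFunction ψ s = A.LSeries s)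
    (ι : PadicAlgCl p ≃+* ℂ) (v vbar : HeightOneSpectrum (𝓞 K))
    (hv : ((p : ℕ) : 𝓞 K) ∈ v.asIdeal) (hvbar : ((p : ℕ) : 𝓞 K) ∈ vbar.asIdeal) (hne : vbar ≠ v)
    (hι : ∀ (w : InfinitePlace K) (k : 𝓞 K), k ∈ v.asIdeal ↔ ‖ι.symm (w.embedding (k : K))‖ < 1)
    (S : Finset (HeightOneSpectrum (𝓞 K))) (hvS : v ∉ S) (hvbS : vbar ∉ S)
    (hSram : ∀ w ∈ S, ¬ ψ.IsUnramifiedAt w)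
    (hSunr : ∀ w : HeightOneSpectrum (𝓞 K), w ∉ S → ψ.IsUnramifiedAt w)
    (κ₁ κ₂ : ZpExtension K p) (γ₁ γ₂ : absoluteGaloisGroup K)
    (hpair : ZpExtension.IsTopGeneratorPair κ₁ κ₂ γ₁ γ₂) (hcyc : κ₂.IsCyclotomic)
    (hγ₂ : ∃ ζ : ℤ_[p]ˣ, IsOfFinOrder ζ ∧
        ((GaloisRep.cyclotomicCharacter K p γ₂ * ζ : ℤ_[p]ˣ) : ℤ_[p]) = (cyclotomicGenerator p : ℤ_[p]))
    (Ω δ : ℂ) (Ωp : ℂ_[p]) (hΩ : Ω ≠ 0) (hΩp : Ωp ≠ 0)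
    (hδ : δ ^ 2 = (NumberField.discr K : ℂ) ∨ δ ^ 2 = -(NumberField.discr K : ℂ))
    (G : PowerSeries (PowerSeries (PadicComplexInt p)))
    (hG : IsKatzMeasure₂ ι v vbar S κ₁ κ₂ γ₁ γ₂ ψ⁻¹ Ω δ Ωp G) :
    ∃ (ε : IsLocalRing.ResidueField (PadicComplexInt p))
      (ιT V : PowerSeries (IsLocalRing.ResidueField (PadicComplexInt p))),
      ε ^ 2 = 1 ∧ (1 + PowerSeries.X) * (ιT + 1) = 1 ∧ PowerSeries.constantCoeff V = 1 ∧
      PowerSeries.subst ιT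
          (PowerSeries.map (IsLocalRing.residue (PadicComplexInt p)) (PowerSeries.constantCoeff G)) =
        PowerSeries.C ε * V *
          PowerSeries.map (IsLocalRing.residue (PadicComplexInt p)) (PowerSeries.constantCoeff G) ∧
      (IsLocalRing.residue (PadicComplexInt p) (PowerSeries.coeff 0 (PowerSeries.coeff 0 G)) = 0 →
        IsLocalRing.residue (PadicComplexInt p) (PowerSeries.coeff 1 (PowerSeries.coeff 0 G)) = 0 →
        IsLocalRing.residue (PadicComplexInt p) (PowerSeries.coeff 0 (PowerSeries.coeff 1 G)) =
          ε * IsLocalRing.residue (PadicComplexInt p) (PowerSeries.coeff 0 (PowerSeries.coeff 1 G))) :=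
  stub_frameSign_of_selfDual A p hp hj K hK κ₁ κ₂ γ₁ γ₂ hpair hcyc G
    (hF A p hp hj hgood hord hirr K hK ψ hψ hL ι v vbar hv hvbar hne hι S hvS hvbS hSram hSunr κ₁ κ₂ γ₁ γ₂
      hpair hcyc hγ₂ Ω δ Ωp hΩ hΩp hδ G hG)

end Summit.BirchSwinnertonDyer.BirchSwinnertonDyer.Theorems.CycTangentCMCycTangentBoundFrameSignFact

end
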